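import Mathlib
import Summits.Ventures.HodgeRepro.Tier4.Target
import Summits.Ventures.HodgeRepro.Tier4.Line3.Defs
import Summits.Ventures.HodgeRepro.Tier4.Line3.KMDatum
import Summits.Ventures.HodgeRepro.Tier4.Line3.KMDatumS
import Summits.Ventures.HodgeRepro.Tier4.Line3.CopyWeightGaussian
import Summits.Ventures.HodgeRepro.Tier4.Line3.CopyWeightBoundShrinkRed
import Summits.Ventures.HodgeRepro.Tier4.Line3.CopyCountRay
import Summits.Ventures.HodgeRepro.Tier4.Line3.HKRayReduction
import Summits.Ventures.HodgeRepro.Tier4.Line3.DatumOrthVanishing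
import Summits.Ventures.HodgeRepro.Tier4.Line3.Transvection

/-!
# Tier4/Line3/KMDilation — the dilation comparison is a DATUM-FREE statement

Blind re-derivation cell `pub-hodge-repro`, Tier 4 «PROVE THE STEP», LINE L3, seat t4-x2 (g4, reserve wall-breaker),
cut C-L3-HKRAY: the consequence of rigidity (bus S14325 (F6)/(F8), Transvection `kernel_eq_kmKernel`) for the display.

`DilationComparison D xm A k` (HKRayReduction) compares integrals of `gaussFree D xm = Re kernel(D.Φ, xm, ·) e^{2π(maj_0+maj_1)}`.
By rigidity `kernel(D.Φ, xm, z) = |c|⁴ · kmKernel xm z` on the ball with `c ≠ 0`, so the comparison for `D` is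
IMPLIED by (indeed equivalent to) the same comparison for the explicit Kudla–Millson kernel — `KMDilationComparison X xm A k`,
a statement about explicit functions of `(E, τ₀, C, xm)` only (`dilationComparison_of_km`).  Hence the (HK′) clause
along the ray follows from the datum-free comparison (`hkRed_ray_of_kmDilationComparison`).

Nothing here says anything about the status of the Hodge conjecture for CM abelian varieties, which is NOT proved
(HC_CM is NOT proved by anyone in this repository).
-/

set_option autoImplicit false

noncomputable section

namespace Summit.Ventures.HodgeRepro.Tier4.Line3

open Summit.Ventures.HodgeRepro.Tier4
open Matrix MeasureTheory
open scoped ComplexConjugate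

/-- The ball is open (`nsq` is continuous). -/
theorem isOpen_ball_nsq : IsOpen ball := by
  have hc : Continuous nsq := by
    unfold nsq
    fun_prop
  exact isOpen_lt hc continuous_const

/-- The ball is measurable. -/
theorem measurableSet_ball_nsq : MeasurableSet ball := isOpen_ball_nsq.measurableSet

/-- Integrands equal on the ball have the same integral over the ball. -/
theorem setIntegral_ball_congr {f g : (Fin 2 → ℂ) → ℝ} (h : ∀ z ∈ ball, f z = g z) :
    ∫ z in ball, f z = ∫ z in ball, g z :=
  setIntegral_congr_fun measurableSet_ball_nsq h

namespace T4Data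

variable (X : T4Data)

/-- The Gaussian-free part of the KM kernel at the centre. -/
def kmGaussFree (xm : X.Tuple) (z : Fin 2 → ℂ) : ℝ :=
  (X.kmKernel xm z).re *
    Real.exp (2 * Real.pi * (maj (X.ballCoord (xm 0)) z + maj (X.ballCoord (xm 1)) z))

/-- The two-parameter KM integrand `P_KM · e^{−π(α m_0 + β m_1)}`. -/
def kmDilInt (xm : X.Tuple) (α β : ℝ) (z : Fin 2 → ℂ) : ℝ :=
  X.kmGaussFree xm z * Real.exp (-(Real.pi * (α * X.redMaj xm 0 z + β * X.redMaj xm 1 z)))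

/-- **THE DATUM-FREE DILATION COMPARISON** for the explicit Kudla–Millson kernel. -/
def KMDilationComparison (xm : X.Tuple) (A k : ℝ) : Prop :=
  ∀ lam : ℝ, 1 ≤ lam → ∀ a b : ℝ, 0 < a → a ≤ 2 → 0 < b → b ≤ 2 →
    IntegrableOn (X.kmDilInt xm (lam * a) (lam * b)) ball ∧
    ∫ z in ball, X.kmDilInt xm (lam * a) (lam * b) z ≤
      A * (2 / a) ^ k * (2 / b) ^ k * ∫ z in ball, X.kmDilInt xm (2 * lam) (2 * lam) z

/-- On the ball the two-parameter integrand of `D` is `|c|⁴` times the KM one. -/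
theorem dilInt_eq_kmDilInt (D : X.ThetaData) (xm : X.Tuple) :
    ∃ r : ℝ, 0 < r ∧ ∀ (α β : ℝ), ∀ z ∈ ball, X.dilInt D xm α β z = r * X.kmDilInt xm α β z := by
  obtain ⟨c, hc0, hc⟩ := D.kernel_eq_kmKernel
  refine ⟨Complex.normSq c ^ 2, pow_pos (Complex.normSq_pos.2 hc0) 2, fun α β z hz => ?_⟩
  have hcc : c ^ 2 * conj c ^ 2 = ((Complex.normSq c ^ 2 : ℝ) : ℂ) := by
    rw [← mul_pow, Complex.mul_conj]
    push_cast
    ring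
  unfold dilInt gaussFree kmDilInt kmGaussFree
  rw [hc xm z hz, hcc, Complex.re_ofReal_mul]
  ring

/-- **THE COMPARISON FOR `D` FROM THE DATUM-FREE ONE** (same `A`, `k`). -/
theorem dilationComparison_of_km (D : X.ThetaData) (xm : X.Tuple) {A k : ℝ}
    (hkm : X.KMDilationComparison xm A k) : X.DilationComparison D xm A k := by
  obtain ⟨r, hr, hrel⟩ := X.dilInt_eq_kmDilInt D xm
  intro lam hlam a b ha0 ha2 hb0 hb2
  obtain ⟨hint, hle⟩ := hkm lam hlam a b ha0 ha2 hb0 hb2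
  refine ⟨?_, ?_⟩
  · exact IntegrableOn.congr_fun (hint.const_mul r) (fun z hz => (hrel _ _ z hz).symm) measurableSet_ball_nsq
  · rw [setIntegral_ball_congr (hrel (lam * a) (lam * b)), setIntegral_ball_congr (hrel (2 * lam) (2 * lam)),
      integral_const_mul, integral_const_mul]
    calc r * ∫ z in ball, X.kmDilInt xm (lam * a) (lam * b) z
        ≤ r * (A * (2 / a) ^ k * (2 / b) ^ k * ∫ z in ball, X.kmDilInt xm (2 * lam) (2 * lam) z) :=
          mul_le_mul_of_nonneg_left hle hr.le
      _ = A * (2 / a) ^ k * (2 / b) ^ k * (r * ∫ z in ball, X.kmDilInt xm (2 * lam) (2 * lam) z) := by ring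

/-- **(HK′) ALONG THE RAY FROM THE DATUM-FREE COMPARISON**: the cut `hkRed_ray` with `KMDilationComparison X xm A k`
displayed — no `ThetaData` in the hypothesis. -/
theorem hkRed_ray_of_kmDilationComparison (D : X.ThetaData) (xm : X.Tuple) (h02 : xm 2 = xm 0) (h13 : xm 3 = xm 1)
    {A k : ℝ} (hA : 0 ≤ A) (hk : 0 ≤ k) (hkm : X.KMDilationComparison xm A k) (n : ℕ) (hn : 1 ≤ n) :
    X.MajorantMomentBoundRed D (X.rayCentre xm n) A k :=
  X.hkRed_ray_of_dilationComparison D xm h02 h13 hA hk (X.dilationComparison_of_km D xm hkm) n hn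

/-- The existential form: `∃ A k ≥ 0, KMDilationComparison X xm A k` gives the (HK′) clause of the ray display for every
`D : X.ThetaData`. -/
theorem hkRed_ray_of_exists_kmDilationComparison (D : X.ThetaData) (xm : X.Tuple) (h02 : xm 2 = xm 0)
    (h13 : xm 3 = xm 1) (hkm : ∃ A k : ℝ, 0 ≤ A ∧ 0 ≤ k ∧ X.KMDilationComparison xm A k) :
    ∃ A k : ℝ, 0 ≤ A ∧ 0 ≤ k ∧ ∀ n : ℕ, 1 ≤ n → X.MajorantMomentBoundRed D (X.rayCentre xm n) A k := by
  obtain ⟨A, k, hA, hk, h⟩ := hkm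
  exact ⟨A, k, hA, hk, fun n hn => X.hkRed_ray_of_kmDilationComparison D xm h02 h13 hA hk h n hn⟩

end T4Data

end Summit.Ventures.HodgeRepro.Tier4.Line3

end
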